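import Mathlib
import HarnessLib
import Literature.RingTheory.CohomologyAnnihilator.StrongGenerator
import Literature.RingTheory.CohomologyAnnihilator.SyzygyBasic
import Literature.RingTheory.CohomologyAnnihilator.SyzygyDescent
import Literature.RingTheory.CohomologyAnnihilator.TowerBasic
import Literature.RingTheory.CohomologyAnnihilator.NoetherDifferentAnnihilator
import Literature.RingTheory.CohomologyAnnihilator.RegularRing
import Literature.RingTheory.CohomologyAnnihilator.RegularLocalRing
import Summits.ResolutionOfSingularities.ResolutionOfSingularities.Theorems.HomologicalConductorPersistencePeriodicSaturation
import Summits.ResolutionOfSingularities.ResolutionOfSingularities.Theorems.HomologicalConductorPersistencePeriodicSaturationStage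
import Summits.ResolutionOfSingularities.ResolutionOfSingularities.Theorems.HomologicalConductorPersistenceQuotientHypersurfacePeriodicity

/-!
# Saturation of the cohomology annihilator at ABSTRACT hypersurface stages:
# `ca(R ⧸ (f)) = caᵈ⁺¹(R ⧸ (f))` for `R` noetherian of global dimension `≤ d + 1`, `f` a nonzerodivisor

Route `ResolutionOfSingularities/HomologicalConductor`, chain W4.4b, rung S-2 `PersistenceSurface`
(stmt-ResolutionOfSingularities-19970); o9 lineage, object o9f part 2/2 (res-L1-w44b-plan-1's Q9-1,
ASSIGN v1.3 2026-08-27: «T ≃+* R′⧸(f), R′ regular local of dim d+1 ⇒ ca T ⊆ caAt (d+1) T» WITHOUT a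
power basis).  [OURS · L1 w44b · res-type-011; AI-written, weaker than expert review; NOT a statement
of the manuscript under study, and no statement of that manuscript is used.]

Ambient: any noetherian `R` with `caᵈ⁺²(R) = R` (finite global dimension `≤ d + 1`: regular rings /
regular local rings of dimension `d + 1` by the tree's `cohomologyAnnihilatorOfDegree_eq_top_of_isRegularRing`
/ `…_of_isRegularLocalRing`), `f` any nonzerodivisor; neither the Auslander–Buchsbaum formula nor a theory
of matrix factorisations is used:
* `hasProjectiveDimensionLT_two_pi_quotient`, `…_two_of_projective_quotient`,
  `hasProjectiveDimensionLT_restrict_of_isSyzygy` — `pd_R Tⁿ ≤ 1` (`0 → Rⁿ —f→ Rⁿ → Tⁿ → 0`),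
  `pd_R P ≤ 1` for f.g. projective `T`-modules, and DIMENSION SHIFTING along `T`-syzygy chains:
  `pd_R M ≤ d + 1 ⇒ pd_R (Ωᵈ_T M) ≤ 1` (Mathlib `ShortExact.hasProjectiveDimensionLT_X₁/X₃`, `Retract`);
* `cohomologyAnnihilator_quotient_span_singleton_eq` — **`ca(R ⧸ (f)) = caᵈ⁺¹(R ⧸ (f))`** (part 1's
  `isSyzygy_two_self_quotient` + o9b `cohomologyAnnihilator_eq_of_isSyzygy_two_self`, p507177);
  `cohomologyAnnihilator_eq_of_ringEquiv_quotient` (any `T ≃+* R ⧸ (f)`),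
  `cohomologyAnnihilator_quotient_eq_of_isRegularLocalRing` (`R` regular local of dimension `d + 1`),
  `cohomologyAnnihilator_quotient_eq_of_isRegularRing` (`R` regular of dimension `≤ d + 1`).
With the o9d adapter (`PeriodicSaturationStage.ca_subset_caAt_of_le` / `cohomologyAnnihilator_eq_of_ringEquiv`)
a tower stage PRESENTED as `↥T_m ≃+* R′ ⧸ (f)`, `R′` regular local of dimension `3`, satisfies `Sat₄`
(`ca ⊆ ca³ ⊆ ca⁴`) — the algebraic half of res-L1-w44b-tri-1's bridge B2; the presentation itself
(embedding dimension `≤ dim + 1`) stays the consumer's input.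
References (mechanism only): D. Eisenbud, Trans. AMS 260 (1980) §5–6; S. B. Iyengar, R. Takahashi,
IMRN 2016 (arXiv:1404.1476) §2 [`IyengarTakahashi2014`].
-/

noncomputable section

-- single-problem summit: the doubled namespace component `ResolutionOfSingularities` is forced
set_option linter.dupNamespace false

namespace Summit.ResolutionOfSingularities.ResolutionOfSingularities.Theorems.HomologicalConductor.QuotientHypersurfaceSaturation

open CategoryTheory TensorProduct Literature.RingTheory.CohomologyAnnihilator
open Summit.ResolutionOfSingularities.ResolutionOfSingularities.Theorems.HomologicalConductor.PeriodicSaturation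
open Summit.ResolutionOfSingularities.ResolutionOfSingularities.Theorems.HomologicalConductor.PeriodicSaturationStage
open Summit.ResolutionOfSingularities.ResolutionOfSingularities.Theorems.HomologicalConductor.QuotientHypersurfacePeriodicity
open scoped TensorProduct

universe u

variable {R : Type u} [CommRing R]

/-- `pd_R (Tⁿ) ≤ 1` for `T = R ⧸ (f)`, `f` a nonzerodivisor: `0 → Rⁿ —f→ Rⁿ → Tⁿ → 0`. [folklore] -/
theorem hasProjectiveDimensionLT_two_pi_quotient (f : R) (hf : f ∈ nonZeroDivisors R) (n : ℕ) :
    HasProjectiveDimensionLT (ModuleCat.of R (Fin n → R ⧸ Ideal.span {f})) 2 := by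
  let q : (Fin n → R) →ₗ[R] (Fin n → R ⧸ Ideal.span {f}) :=
    (Algebra.linearMap R (R ⧸ Ideal.span {f})).compLeft (Fin n)
  have hq : ∀ v i, q v i = Ideal.Quotient.mk (Ideal.span {f}) (v i) := fun v i => rfl
  have hqsurj : Function.Surjective q := fun w => by
    choose v hv using fun i => Ideal.Quotient.mk_surjective (w i)
    exact ⟨v, funext fun i => by rw [hq, hv]⟩
  let mf : (Fin n → R) →ₗ[R] (Fin n → R) := f • LinearMap.id
  have hmf : ∀ v, mf v = f • v := fun v => rfl
  have hinj : Function.Injective mf := by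
    intro v v' h
    rw [hmf, hmf] at h
    funext i
    have hi := congrFun h i
    simp only [Pi.smul_apply, smul_eq_mul] at hi
    exact (mul_cancel_left_mem_nonZeroDivisors hf).mp hi
  have hex : Function.Exact mf q := by
    intro v
    constructor
    · intro hv
      have hvi : ∀ i, ∃ r, v i = f * r := fun i => by
        have : Ideal.Quotient.mk (Ideal.span {f}) (v i) = 0 := by rw [← hq]; exact congrFun hv i
        rw [Ideal.Quotient.eq_zero_iff_mem, Ideal.mem_span_singleton'] at this
        obtain ⟨r, hr⟩ := this
        exact ⟨r, by rw [← hr, mul_comm]⟩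
      choose r hr using hvi
      refine ⟨r, funext fun i => ?_⟩
      rw [hmf, Pi.smul_apply, smul_eq_mul, ← hr]
    · rintro ⟨v', rfl⟩
      funext i
      rw [hq, hmf, Pi.smul_apply, smul_eq_mul, Pi.zero_apply, Ideal.Quotient.eq_zero_iff_mem]
      exact Ideal.mul_mem_right _ _ (Ideal.subset_span rfl)
  obtain ⟨w, hS⟩ := exists_shortExact_of_linearMap (Y := ModuleCat.of R (Fin n → R))
    (M := ModuleCat.of R (Fin n → R)) (X := ModuleCat.of R (Fin n → R ⧸ Ideal.span {f})) mf q hinj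
    hqsurj hex
  haveI : Projective (ModuleCat.of R (Fin n → R)) :=
    (IsProjective.iff_projective (R := R) (Fin n → R)).mp inferInstance
  exact hS.hasProjectiveDimensionLT_X₃ 1 inferInstance inferInstance

/-- `pd_R P ≤ 1` for every finitely generated projective module `P` over `T = R ⧸ (f)` (a retract of
some `Tⁿ`, Mathlib `Retract.hasProjectiveDimensionLT`). [folklore] -/
theorem hasProjectiveDimensionLT_two_of_projective_quotient (f : R) (hf : f ∈ nonZeroDivisors R)
    (P : ModuleCat.{u} (R ⧸ Ideal.span {f})) [Module.Finite (R ⧸ Ideal.span {f}) P]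
    [Module.Projective (R ⧸ Ideal.span {f}) P] :
    HasProjectiveDimensionLT ((restrictScalarsFunctor R (R ⧸ Ideal.span {f})).obj P) 2 := by
  obtain ⟨n, g, hg⟩ := Module.Finite.exists_fin' (R ⧸ Ideal.span {f}) P
  obtain ⟨s, hs⟩ := Module.projective_lifting_property g LinearMap.id hg
  letI : Module R P := Module.compHom P (Ideal.Quotient.mk (Ideal.span {f}))
  haveI : IsScalarTower R (R ⧸ Ideal.span {f}) P := IsScalarTower.of_algebraMap_smul fun _ _ => rfl
  -- `P|_R` is a retract of `(Tⁿ)|_R`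
  haveI := hasProjectiveDimensionLT_two_pi_quotient f hf n
  refine Retract.hasProjectiveDimensionLT (Y := ModuleCat.of R (Fin n → R ⧸ Ideal.span {f})) ?_ 2
  refine ⟨ModuleCat.ofHom (X := (restrictScalarsFunctor R (R ⧸ Ideal.span {f})).obj P)
      (Y := ModuleCat.of R (Fin n → R ⧸ Ideal.span {f})) (s.restrictScalars R),
    ModuleCat.ofHom (X := ModuleCat.of R (Fin n → R ⧸ Ideal.span {f}))
      (Y := (restrictScalarsFunctor R (R ⧸ Ideal.span {f})).obj P)
      (g.restrictScalars R), ?_⟩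
  ext x
  exact LinearMap.congr_fun hs x

/-- **Dimension shifting through the hypersurface.** Along a `T`-syzygy chain (`T = R ⧸ (f)`), an
`s`-th syzygy `K` of a module `M` with `pd_R M < N + s` has `pd_R K < N` for every `N ≥ 2` — the
projective `T`-modules of the chain have `pd_R ≤ 1` (previous lemma) and Mathlib's
`ShortExact.hasProjectiveDimensionLT_X₁` shifts. In particular (`N = 2`, `s = d`): if `pd_R M ≤ d + 1`
then every `d`-th `T`-syzygy of `M` has `pd_R ≤ 1` — WITHOUT the Auslander–Buchsbaum formula. [OURS] -/
theorem hasProjectiveDimensionLT_restrict_of_isSyzygy (f : R) (hf : f ∈ nonZeroDivisors R) :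
    ∀ (s : ℕ) {M K : ModuleCat.{u} (R ⧸ Ideal.span {f})}, IsSyzygy s M K → ∀ (N : ℕ), 2 ≤ N →
      HasProjectiveDimensionLT ((restrictScalarsFunctor R (R ⧸ Ideal.span {f})).obj M) (N + s) →
        HasProjectiveDimensionLT ((restrictScalarsFunctor R (R ⧸ Ideal.span {f})).obj K) N
  | 0, _, _, ⟨e⟩, N, _, h => by
    haveI := h
    exact hasProjectiveDimensionLT_of_iso
      ((restrictScalarsFunctor R (R ⧸ Ideal.span {f})).mapIso e.symm) N
  | s + 1, M, K, ⟨K', P, hK', hPfin, hPproj, g, g', w, hS⟩, N, hN, h => by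
    haveI := hPfin
    haveI : Module.Projective (R ⧸ Ideal.span {f}) P := moduleProjective_of_projective P hPproj
    have hK'pd : HasProjectiveDimensionLT
        ((restrictScalarsFunctor R (R ⧸ Ideal.span {f})).obj K') (N + 1) :=
      hasProjectiveDimensionLT_restrict_of_isSyzygy f hf s hK' (N + 1) (by omega)
        (by rwa [show N + 1 + s = N + (s + 1) by omega])
    haveI := hasProjectiveDimensionLT_two_of_projective_quotient f hf P
    have hPpd : HasProjectiveDimensionLT
        ((restrictScalarsFunctor R (R ⧸ Ideal.span {f})).obj P) N :=
      hasProjectiveDimensionLT_of_ge _ 2 N hN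
    exact (hS.map_of_exact (restrictScalarsFunctor R (R ⧸ Ideal.span {f}))).hasProjectiveDimensionLT_X₁
      N hPpd hK'pd

/-- **Saturation of the cohomology annihilator of an ABSTRACT hypersurface ring.** Let `R` be
noetherian with `caᵈ⁺²(R) = R` (every finitely generated `R`-module has projective dimension
`≤ d + 1`; e.g. `R` regular, or regular local, of dimension `d + 1`) and `f ∈ R` a nonzerodivisor.
Then `ca(R ⧸ (f)) = caᵈ⁺¹(R ⧸ (f))`: `d`-th syzygies over `R ⧸ (f)` have `pd_R ≤ 1` (shifting), hence are
`2`-periodic (abstract hypersurface periodicity), and periodic saturation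
(`PeriodicSaturation.cohomologyAnnihilator_eq_of_isSyzygy_two_self`, p507177) applies. No power
basis over a regular subring is needed (compare o9b/o9c). [OURS] -/
theorem cohomologyAnnihilator_quotient_span_singleton_eq [IsNoetherianRing R] (f : R)
    (hf : f ∈ nonZeroDivisors R) {d : ℕ} (hR : cohomologyAnnihilatorOfDegree R (d + 2) = ⊤) :
    cohomologyAnnihilator (R ⧸ Ideal.span {f}) =
      cohomologyAnnihilatorOfDegree (R ⧸ Ideal.span {f}) (d + 1) := by
  haveI : IsNoetherianRing (R ⧸ Ideal.span {f}) := inferInstance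
  refine cohomologyAnnihilator_eq_of_isSyzygy_two_self
    d (fun M K hM hK => ?_)
  haveI := hM
  -- `pd_R M ≤ d + 1`, hence `pd_R K ≤ 1` for the `d`-th syzygy `K`
  haveI : Module.Finite R (R ⧸ Ideal.span {f}) :=
    Module.Finite.of_surjective (Algebra.linearMap R (R ⧸ Ideal.span {f}))
      Ideal.Quotient.mk_surjective
  haveI : Module.Finite R ((restrictScalarsFunctor R (R ⧸ Ideal.span {f})).obj M) :=
    finite_restrictScalars M
  have hMpd : HasProjectiveDimensionLT
      ((restrictScalarsFunctor R (R ⧸ Ideal.span {f})).obj M) (2 + d) := by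
    rw [show 2 + d = d + 2 by omega]
    exact hasProjectiveDimensionLT_of_cohomologyAnnihilatorOfDegree_eq_top hR _
  have hKpd := hasProjectiveDimensionLT_restrict_of_isSyzygy f hf d hK 2 le_rfl hMpd
  letI : Module R K := Module.compHom K (Ideal.Quotient.mk (Ideal.span {f}))
  haveI : IsScalarTower R (R ⧸ Ideal.span {f}) K := IsScalarTower.of_algebraMap_smul fun _ _ => rfl
  haveI : Module.Finite (R ⧸ Ideal.span {f}) K := finite_of_isSyzygy d hM hK
  exact isSyzygy_two_self_quotient f hf K hKpd

/-- Any ring `T ≃+* R ⧸ (f)` PRESENTED as an abstract hypersurface (same hypotheses on `R`, `f`) has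
`ca(T) = caᵈ⁺¹(T)` (transport `PeriodicSaturationStage.cohomologyAnnihilator_eq_of_ringEquiv`). [OURS] -/
theorem cohomologyAnnihilator_eq_of_ringEquiv_quotient [IsNoetherianRing R] (f : R)
    (hf : f ∈ nonZeroDivisors R) {d : ℕ} (hR : cohomologyAnnihilatorOfDegree R (d + 2) = ⊤)
    {T : Type u} [CommRing T] (e : T ≃+* R ⧸ Ideal.span {f}) :
    cohomologyAnnihilator T = cohomologyAnnihilatorOfDegree T (d + 1) :=
  cohomologyAnnihilator_eq_of_ringEquiv
    e (cohomologyAnnihilator_quotient_span_singleton_eq f hf hR)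

/-- **Regular local ambient**: `R` a regular local ring of dimension `d + 1`, `f` a nonzerodivisor
(e.g. any `f ≠ 0`, `R` being a domain): `ca(R ⧸ (f)) = caᵈ⁺¹(R ⧸ (f))` — the abstract hypersurface STAGE
(tree `cohomologyAnnihilatorOfDegree_eq_top_of_isRegularLocalRing`). [OURS] -/
theorem cohomologyAnnihilator_quotient_eq_of_isRegularLocalRing [IsRegularLocalRing R] {d : ℕ}
    (hd : ringKrullDim R = (d + 1 : ℕ)) (f : R) (hf : f ∈ nonZeroDivisors R) :
    cohomologyAnnihilator (R ⧸ Ideal.span {f}) =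
      cohomologyAnnihilatorOfDegree (R ⧸ Ideal.span {f}) (d + 1) :=
  cohomologyAnnihilator_quotient_span_singleton_eq f hf
    (cohomologyAnnihilatorOfDegree_eq_top_of_isRegularLocalRing (R := R) hd)

/-- **Regular ambient**: `R` a regular ring of Krull dimension `≤ d + 1`, `f` a nonzerodivisor:
`ca(R ⧸ (f)) = caᵈ⁺¹(R ⧸ (f))` (tree `cohomologyAnnihilatorOfDegree_eq_top_of_isRegularRing`). [OURS] -/
theorem cohomologyAnnihilator_quotient_eq_of_isRegularRing [IsRegularRing R] {d : ℕ}
    (hd : ringKrullDim R ≤ (d + 1 : ℕ)) (f : R) (hf : f ∈ nonZeroDivisors R) :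
    cohomologyAnnihilator (R ⧸ Ideal.span {f}) =
      cohomologyAnnihilatorOfDegree (R ⧸ Ideal.span {f}) (d + 1) :=
  cohomologyAnnihilator_quotient_span_singleton_eq f hf
    (cohomologyAnnihilatorOfDegree_eq_top_of_isRegularRing R hd)



end Summit.ResolutionOfSingularities.ResolutionOfSingularities.Theorems.HomologicalConductor.QuotientHypersurfaceSaturation

end
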